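import Literature.Barriers.RiemannHypothesis.TuranPartialSumsMontgomeryLine
import HarnessLib

/-!
# Montgomery 1983 "mutatis mutandis" — the line integral with a general smooth kernel factor

Proofs-only companion of `Literature/Barriers/RiemannHypothesis/TuranPartialSums.lean` (named fact
`Literature.Barriers.RiemannHypothesis.montgomery1983_smoothedRemark`, Montgomery 1983, §1 p. 498) and of
`TuranPartialSumsMontgomeryLine.lean` (the line integral of §4 of the source, piece by piece, for the
sharp kernel `x^w/w`). No definitions of substance (one abbreviation), no named facts.

For the smoothed approximants the kernel `1/w` of (3)/(5) is replaced by `1/(w(w+1))` (`C_N`), `Γ(w)`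
(`A_N`), and `(2a(2)2^{-s-w} − 1)/w` (`V_N`) — each of the form `η/w` with a factor `η` which is bounded
together with its derivative along the line of integration. This file redoes the three piece estimates
of `TuranPartialSumsMontgomeryLine.lean` ((21)–(24) of the source) for the piece integrand multiplied by
such a factor `η(v)` (`gpiece = pieceFun · η`, `|η|, |η'| ≤ H` on the piece):

* `norm_gpiece_sub_window_le`, `norm_gpiece_le` — the pieces `k ≠ 0` (one integration by parts; the
  bounds of the sharp case with `M ↦ MH`, `L ↦ L + 1`);
* `norm_gwindowOne_sub_main_le` — the window about `k = 1` carries the main term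
  `η(0) g₁(0)/(α + i(1−t)) · ∫ (1/Λ+iv)^{-β} e^{iΛv} dv` (freezing `η` costs `16 M₁ H w₀^{2−β}` more);
* `norm_gpieceZero_le` — the piece `k = 0`;
* `sum_norm_gpieces_le` — the sum over `k ∉ {0, 1}`;
* `integral_eq_sum_unit_pieces` — cutting `∫_{-K₀-1/2-t}^{K₀+1/2-t} G(u) du` into unit pieces.

## References

* [Montgomery1983] H. L. Montgomery, *Zeros of approximations to the zeta function*, Studies in Pure
  Mathematics (Turán memorial), Birkhäuser 1983, 497–506: §1 p. 498 (the remark on `C_N`, `V_N`, `A_N`),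
  §4 (20)–(24).
-/

noncomputable section

open Complex Set Filter Topology MeasureTheory intervalIntegral
open scoped Interval

namespace Literature.Barriers.RiemannHypothesis

section Line

variable (m : ℕ)

/-- The `k`-th piece integrand with a kernel factor: `h_k(v) η(v) = f(z) η(v)/(α + i(k+v−t))`,
`z = zline(k+v)` (`pieceFun` with `c = 1`, times `η`). [cite: Montgomery1983, §4 (20)] -/
def gpiece (Λ α t : ℝ) (η : ℝ → ℂ) (k : ℤ) (v : ℝ) : ℂ :=
  pieceFun m Λ α t 1 k v * η v

/-- The derivative of `pieceFun` (with `c = 1`), as a named function of `v`. [folklore] -/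
def pieceFunDeriv (Λ α t : ℝ) (k : ℤ) (v : ℝ) : ℂ :=
  I * 1 * (deriv (montgomeryF m) (zline Λ (k + v)) / ((α : ℂ) + (((k : ℝ) + v - t : ℝ) : ℂ) * I) -
    montgomeryF m (zline Λ (k + v)) / ((α : ℂ) + (((k : ℝ) + v - t : ℝ) : ℂ) * I) ^ 2)

/-- **The derivative of the piece integrand with a kernel factor** (`k ≠ 0`, `|t| ≤ 1/4`, `|v| ≤ 1/2`):
`(h_k η)' = h_k' η + h_k η'`. [folklore] -/
theorem hasDerivAt_gpiece {Λ : ℝ} (hΛ : 2 ≤ Λ) {α t : ℝ} {η η' : ℝ → ℂ} {k : ℤ} (hk : k ≠ 0)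
    (ht : |t| ≤ 1 / 4) {v : ℝ} (hv : |v| ≤ 1 / 2) (hη : HasDerivAt η (η' v) v) :
    HasDerivAt (gpiece m Λ α t η k)
      (pieceFunDeriv m Λ α t k v * η v + pieceFun m Λ α t 1 k v * η' v) v := by
  unfold gpiece pieceFunDeriv
  exact (hasDerivAt_pieceFun m hΛ 1 hk ht hv).mul hη

section PieceBounds

variable {A₁ A₂ A₃ A₄ : ℝ}
  (h18 : ∀ (k : ℤ) (z : ℂ), 1 < z.re → z.re ≤ 2 → |z.im - k| ≤ 1 / 2 →
    ‖montgomeryPhi m z + (montgomeryCoeff m k : ℂ) * log (z - 1 - k * I)‖ ≤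
      A₁ + A₂ * Real.log (Real.log (|(k : ℝ)| + 5)))
  (h19 : ∀ (k : ℤ) (z : ℂ), 1 < z.re → z.re ≤ 2 → |z.im - k| ≤ 1 / 2 →
    ‖montgomeryPhiDeriv m z + (montgomeryCoeff m k : ℂ) / (z - 1 - k * I)‖ ≤ A₃ + A₄ * Real.log (|(k : ℝ)| + 5))
include h18

/-- `|h_k η|` off the window: `≤ (8MH/|k|)|v|^{-b̂(k)}` (`1/Λ ≤ |v| ≤ 1/2`, `‖η v‖ ≤ H`).
[cite: Montgomery1983, §4 (21)] -/
theorem norm_gpiece_le_off {Λ : ℝ} (hΛ : 2 ≤ Λ) {α t : ℝ} (ht : |t| ≤ 1 / 4) {η : ℝ → ℂ} {H : ℝ}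
    {k : ℤ} (hk : k ≠ 0) {v : ℝ} (hv1 : 1 / Λ ≤ |v|) (hv2 : |v| ≤ 1 / 2) (hηv : ‖η v‖ ≤ H) :
    ‖gpiece m Λ α t η k v‖ ≤ 8 * Real.exp (A₁ + A₂ * Real.log (Real.log (|(k : ℝ)| + 5))) / |(k : ℝ)| *
      |v| ^ (-montgomeryCoeff m k) * H := by
  have h := norm_pieceFun_le_off m h18 hΛ (α := α) ht (c := 1) (by simp) hk hv1 hv2
  rw [gpiece, norm_mul]
  exact mul_le_mul h hηv (norm_nonneg _) (le_trans (norm_nonneg _) h)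

/-- `|h_k η|` on the window: `≤ (4MH/|k|) Λ^{max(b̂(k),0)}` (`|v| ≤ 1/2`). [cite: Montgomery1983, §4 (21)] -/
theorem norm_gpiece_le_window {Λ : ℝ} (hΛ : 2 ≤ Λ) {α t : ℝ} (ht : |t| ≤ 1 / 4) {η : ℝ → ℂ} {H : ℝ}
    {k : ℤ} (hk : k ≠ 0) {v : ℝ} (hv2 : |v| ≤ 1 / 2) (hηv : ‖η v‖ ≤ H) :
    ‖gpiece m Λ α t η k v‖ ≤ 4 * Real.exp (A₁ + A₂ * Real.log (Real.log (|(k : ℝ)| + 5))) / |(k : ℝ)| *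
      Λ ^ (max (montgomeryCoeff m k) 0) * H := by
  have h := norm_pieceFun_le_window m h18 hΛ (α := α) ht (c := 1) (by simp) hk hv2
  rw [gpiece, norm_mul]
  exact mul_le_mul h hηv (norm_nonneg _) (le_trans (norm_nonneg _) h)

include h19

/-- `|(h_k η)'|` off the window: `≤ (8MH/|k|)|v|^{-b̂(k)}(|b̂(k)|/|v| + (L_k + 1) + 4)` for
`1/Λ ≤ |v| ≤ 1/2`, `‖η v‖, ‖η' v‖ ≤ H`. [cite: Montgomery1983, §4 (21), Lemma 4 (19)] -/
theorem norm_gpieceDeriv_le_off (hA₃ : 0 ≤ A₃) (hA₄ : 0 ≤ A₄) {Λ : ℝ} (hΛ : 2 ≤ Λ) {α t : ℝ}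
    (ht : |t| ≤ 1 / 4) {η η' : ℝ → ℂ} {H : ℝ} {k : ℤ} (hk : k ≠ 0) {v : ℝ} (hv1 : 1 / Λ ≤ |v|)
    (hv2 : |v| ≤ 1 / 2) (hηv : ‖η v‖ ≤ H) (hη'v : ‖η' v‖ ≤ H) :
    ‖pieceFunDeriv m Λ α t k v * η v + pieceFun m Λ α t 1 k v * η' v‖ ≤
      8 * Real.exp (A₁ + A₂ * Real.log (Real.log (|(k : ℝ)| + 5))) / |(k : ℝ)| * |v| ^ (-montgomeryCoeff m k) *
        (|montgomeryCoeff m k| / |v| + (A₃ + A₄ * Real.log (|(k : ℝ)| + 5) + 1) + 4) * H := by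
  have hD := norm_pieceFunDeriv_le_off m h18 h19 hA₃ hA₄ hΛ (α := α) ht (c := 1) (by simp) hk hv1 hv2
  have hF := norm_pieceFun_le_off m h18 hΛ (α := α) ht (c := 1) (by simp) hk hv1 hv2
  have hH : 0 ≤ H := le_trans (norm_nonneg _) hηv
  set P := 8 * Real.exp (A₁ + A₂ * Real.log (Real.log (|(k : ℝ)| + 5))) / |(k : ℝ)| *
    |v| ^ (-montgomeryCoeff m k) with hP
  have hP0 : 0 ≤ P := by rw [hP]; positivity
  calc ‖pieceFunDeriv m Λ α t k v * η v + pieceFun m Λ α t 1 k v * η' v‖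
      ≤ ‖pieceFunDeriv m Λ α t k v‖ * ‖η v‖ + ‖pieceFun m Λ α t 1 k v‖ * ‖η' v‖ := by
        refine (norm_add_le _ _).trans ?_; rw [norm_mul, norm_mul]
    _ ≤ (P * (|montgomeryCoeff m k| / |v| + (A₃ + A₄ * Real.log (|(k : ℝ)| + 5)) + 4)) * H + P * H := by
        refine add_le_add (mul_le_mul hD hηv (norm_nonneg _) ?_) (mul_le_mul hF hη'v (norm_nonneg _) hP0)
        exact le_trans (norm_nonneg _) hD
    _ = _ := by ring

omit h18 h19 in
/-- Continuity of the piece integrand with a kernel factor and of its derivative on `|v| ≤ 1/2`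
(`k ≠ 0`; `η` differentiable with continuous derivative `η'` there). [folklore] -/
theorem continuousOn_gpiece {Λ : ℝ} (hΛ : 2 ≤ Λ) {α t : ℝ} (ht : |t| ≤ 1 / 4) {η η' : ℝ → ℂ}
    {k : ℤ} (hk : k ≠ 0) (hηd : ∀ v ∈ Icc (-(1 / 2) : ℝ) (1 / 2), HasDerivAt η (η' v) v)
    (hηc : ContinuousOn η' (Icc (-(1 / 2)) (1 / 2))) :
    ContinuousOn (gpiece m Λ α t η k) (Icc (-(1 / 2)) (1 / 2)) ∧
    ContinuousOn (fun v : ℝ ↦ pieceFunDeriv m Λ α t k v * η v + pieceFun m Λ α t 1 k v * η' v)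
      (Icc (-(1 / 2)) (1 / 2)) := by
  obtain ⟨h1, h2⟩ := continuousOn_pieceFun m hΛ (α := α) ht 1 hk
  have hηcont : ContinuousOn η (Icc (-(1 / 2)) (1 / 2)) :=
    fun v hv ↦ (hηd v hv).continuousAt.continuousWithinAt
  refine ⟨h1.mul hηcont, ?_⟩
  have h2' : ContinuousOn (pieceFunDeriv m Λ α t k) (Icc (-(1 / 2)) (1 / 2)) := h2
  exact (h2'.mul hηcont).add (h1.mul hηc)

/-- **The `k`-th piece (with a kernel factor) minus its window is small** (`k ≠ 0`; one integration by
parts on each side): for `1/Λ ≤ r ≤ 1/2` and `|η|, |η'| ≤ H` on the piece,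
`‖∫_{-1/2}^{1/2} h_k η e^{iΛv} − ∫_{-r}^{r} h_k η e^{iΛv}‖ ≤ (16MH/(Λ|k|))(2r^{-max(b̂(k),0)} + 3(L_k+1) + 14)`.
[cite: Montgomery1983, §4 (21)] -/
theorem norm_gpiece_sub_window_le (hA₃ : 0 ≤ A₃) (hA₄ : 0 ≤ A₄) {Λ : ℝ} (hΛ : 2 ≤ Λ) {α t : ℝ}
    (ht : |t| ≤ 1 / 4) {η η' : ℝ → ℂ} {H : ℝ} {k : ℤ} (hk : k ≠ 0) {r : ℝ} (hr1 : 1 / Λ ≤ r) (hr2 : r ≤ 1 / 2)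
    (hηd : ∀ v ∈ Icc (-(1 / 2) : ℝ) (1 / 2), HasDerivAt η (η' v) v)
    (hηc : ContinuousOn η' (Icc (-(1 / 2)) (1 / 2)))
    (hηb : ∀ v ∈ Icc (-(1 / 2) : ℝ) (1 / 2), ‖η v‖ ≤ H)
    (hηb' : ∀ v ∈ Icc (-(1 / 2) : ℝ) (1 / 2), ‖η' v‖ ≤ H) :
    ‖(∫ v in (-(1 / 2))..(1 / 2), gpiece m Λ α t η k v * exp (((Λ * v : ℝ) : ℂ) * I)) -
        ∫ v in (-r)..r, gpiece m Λ α t η k v * exp (((Λ * v : ℝ) : ℂ) * I)‖ ≤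
      16 * Real.exp (A₁ + A₂ * Real.log (Real.log (|(k : ℝ)| + 5))) * H / (Λ * |(k : ℝ)|) *
        (2 * r ^ (-(max (montgomeryCoeff m k) 0)) + 3 * (A₃ + A₄ * Real.log (|(k : ℝ)| + 5) + 1) + 14) := by
  have hΛ0 : 0 < Λ := by linarith
  have hr0 : 0 < r := (one_div_pos.2 hΛ0).trans_le hr1
  have hH : 0 ≤ H := le_trans (norm_nonneg _) (hηb 0 (by constructor <;> norm_num))
  set M := Real.exp (A₁ + A₂ * Real.log (Real.log (|(k : ℝ)| + 5))) with hM
  set L := A₃ + A₄ * Real.log (|(k : ℝ)| + 5) + 1 with hL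
  set b := montgomeryCoeff m k with hbdef
  have hM0 : 0 < M := Real.exp_pos _
  have hL0 : 0 ≤ L := by
    rw [hL]
    exact add_nonneg (add_nonneg hA₃ (mul_nonneg hA₄ ((one_le_log_abs_add_five _).trans' zero_le_one)))
      zero_le_one
  have hk1 : 1 ≤ |(k : ℝ)| := by exact_mod_cast Int.one_le_abs hk
  have hk0 : 0 < |(k : ℝ)| := by linarith
  have hb23 : b ≤ 2 / 3 := (montgomeryCoeff_le m k).trans (by
    rw [div_le_div_iff₀ Real.pi_pos (by norm_num)]; linarith [Real.pi_gt_three])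
  have hvmem : ∀ v : ℝ, |v| ≤ 1 / 2 → v ∈ Icc (-(1 / 2) : ℝ) (1 / 2) := fun v hv ↦
    ⟨(abs_le.1 hv).1, (abs_le.1 hv).2⟩
  set h : ℝ → ℂ := gpiece m Λ α t η k with hh
  set h' : ℝ → ℂ := fun v ↦ pieceFunDeriv m Λ α t k v * η v + pieceFun m Λ α t 1 k v * η' v with hh'
  obtain ⟨hcont, hcont'⟩ := continuousOn_gpiece m hΛ (α := α) ht hk hηd hηc
  have hderiv : ∀ v : ℝ, |v| ≤ 1 / 2 → HasDerivAt h (h' v) v := fun v hv ↦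
    hasDerivAt_gpiece m hΛ hk ht hv (hηd v (hvmem v hv))
  -- pointwise bounds off the window
  set g : ℝ → ℝ := fun v ↦ 8 * (M * H) / |(k : ℝ)| * v ^ (-b) * (|b| / v + L + 4) with hg
  have hh_off : ∀ v : ℝ, r ≤ |v| → |v| ≤ 1 / 2 → ‖h v‖ ≤ 8 * (M * H) / |(k : ℝ)| * |v| ^ (-b) := by
    intro v hv1 hv2
    have := norm_gpiece_le_off m h18 hΛ (α := α) ht hk (hr1.trans hv1) hv2 (hηb v (hvmem v hv2))
    refine this.trans (le_of_eq ?_)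
    simp only [hM, hbdef]; ring
  have hh'_off : ∀ v : ℝ, r ≤ |v| → |v| ≤ 1 / 2 → ‖h' v‖ ≤ g |v| := by
    intro v hv1 hv2
    have := norm_gpieceDeriv_le_off m h18 h19 hA₃ hA₄ hΛ (α := α) ht hk (hr1.trans hv1) hv2
      (hηb v (hvmem v hv2)) (hηb' v (hvmem v hv2))
    refine this.trans (le_of_eq ?_)
    simp only [hg, hM, hL, hbdef]; ring
  -- boundary values
  have hr_le : r ^ (-b) ≤ r ^ (-(max b 0)) :=
    Real.rpow_le_rpow_of_exponent_ge hr0 (by linarith) (by simp)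
  have hhalf : (1 / 2 : ℝ) ^ (-b) ≤ 2 := by
    rw [Real.div_rpow zero_le_one zero_le_two, Real.one_rpow, Real.rpow_neg zero_le_two, one_div, inv_inv]
    calc (2 : ℝ) ^ b ≤ (2 : ℝ) ^ (1 : ℝ) := Real.rpow_le_rpow_of_exponent_le one_le_two (by linarith)
      _ = 2 := Real.rpow_one _
  have hbd_r : ∀ v : ℝ, |v| = r → ‖h v‖ ≤ 8 * (M * H) / |(k : ℝ)| * r ^ (-(max b 0)) := by
    intro v hv
    refine (hh_off v (by rw [hv]) (by rw [hv]; exact hr2)).trans ?_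
    rw [hv]; exact mul_le_mul_of_nonneg_left hr_le (by positivity)
  have hbd_half : ∀ v : ℝ, |v| = 1 / 2 → ‖h v‖ ≤ 8 * (M * H) / |(k : ℝ)| * 2 := by
    intro v hv
    refine (hh_off v (by rw [hv]; exact hr2) (by rw [hv])).trans ?_
    rw [hv]; exact mul_le_mul_of_nonneg_left hhalf (by positivity)
  -- the integral of the derivative bound on one side
  have hg_cont : ContinuousOn g (Icc r (1 / 2)) := by
    intro v hv
    have hv0 : 0 < v := hr0.trans_le hv.1
    simp only [hg]
    exact ((continuousAt_const.mul (Real.continuousAt_rpow_const _ _ (Or.inl hv0.ne'))).mul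
      (((continuousAt_const.div continuousAt_id hv0.ne').add continuousAt_const).add continuousAt_const)).continuousWithinAt
  have hIg : ∫ v in r..(1 / 2), g v ≤ 8 * (M * H) / |(k : ℝ)| * (r ^ (-(max b 0)) + 3 * (L + 4)) :=
    integral_pieceBound_le (mul_nonneg hM0.le hH) hk0 hL0 hb23 hr0 hr2
  -- right side `[r, 1/2]`
  have hR : ‖∫ v in r..(1 / 2), h v * exp (((Λ * v : ℝ) : ℂ) * I)‖ ≤
      (8 * (M * H) / |(k : ℝ)| * r ^ (-(max b 0)) + 8 * (M * H) / |(k : ℝ)| * 2 +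
        8 * (M * H) / |(k : ℝ)| * (r ^ (-(max b 0)) + 3 * (L + 4))) / Λ := by
    have hsub : Icc r (1 / 2) ⊆ Icc (-(1 / 2) : ℝ) (1 / 2) := Icc_subset_Icc (by linarith) le_rfl
    refine (norm_integral_mul_exp_le hr2 hΛ0 (fun v hv ↦ hderiv v (abs_le.2 ⟨by linarith [hv.1], hv.2⟩))
      (hcont'.mono hsub)).trans ?_
    refine div_le_div_of_nonneg_right (add_le_add (add_le_add (hbd_r r (abs_of_pos hr0))
      (hbd_half (1 / 2) (abs_of_pos (by norm_num)))) ?_) hΛ0.le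
    refine le_trans (intervalIntegral.integral_mono_on hr2 ?_ (hg_cont.intervalIntegrable_of_Icc hr2)
      fun v hv ↦ ?_) hIg
    · exact ((hcont'.mono hsub).norm).intervalIntegrable_of_Icc hr2
    · have hv0 : 0 < v := hr0.trans_le hv.1
      have := hh'_off v (by rw [abs_of_pos hv0]; exact hv.1) (by rw [abs_of_pos hv0]; exact hv.2)
      rwa [abs_of_pos hv0] at this
  -- left side `[-1/2, -r]`
  have hLft : ‖∫ v in (-(1 / 2))..(-r), h v * exp (((Λ * v : ℝ) : ℂ) * I)‖ ≤
      (8 * (M * H) / |(k : ℝ)| * 2 + 8 * (M * H) / |(k : ℝ)| * r ^ (-(max b 0)) +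
        8 * (M * H) / |(k : ℝ)| * (r ^ (-(max b 0)) + 3 * (L + 4))) / Λ := by
    have hsub : Icc (-(1 / 2) : ℝ) (-r) ⊆ Icc (-(1 / 2) : ℝ) (1 / 2) := Icc_subset_Icc le_rfl (by linarith)
    have hle : -(1 / 2 : ℝ) ≤ -r := by linarith
    refine (norm_integral_mul_exp_le hle hΛ0 (fun v hv ↦ hderiv v (abs_le.2 ⟨hv.1, by linarith [hv.2]⟩))
      (hcont'.mono hsub)).trans ?_
    refine div_le_div_of_nonneg_right (add_le_add (add_le_add
      (hbd_half _ (by rw [abs_neg, abs_of_pos (by norm_num)]))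
      (hbd_r _ (by rw [abs_neg, abs_of_pos hr0]))) ?_) hΛ0.le
    have hcomp : ∫ v in (-(1 / 2))..(-r), g |v| = ∫ v in r..(1 / 2), g v := by
      rw [← intervalIntegral.integral_comp_neg]
      refine intervalIntegral.integral_congr fun v hv ↦ ?_
      rw [uIcc_of_le hr2] at hv
      simp [abs_neg, abs_of_pos (hr0.trans_le hv.1)]
    refine le_trans (intervalIntegral.integral_mono_on hle ?_ ?_ fun v hv ↦ ?_) (hcomp ▸ hIg)
    · exact ((hcont'.mono hsub).norm).intervalIntegrable_of_Icc hle
    · refine (ContinuousOn.intervalIntegrable_of_Icc hle ?_)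
      intro v hv
      have hv0 : v < 0 := by linarith [hv.2]
      have : ContinuousWithinAt (fun v : ℝ ↦ g (-v)) (Icc (-(1 / 2)) (-r)) v := by
        refine ((hg_cont (-v) ⟨by linarith [hv.2], by linarith [hv.1]⟩).comp continuous_neg.continuousWithinAt ?_)
        intro u hu; exact ⟨by linarith [hu.2], by linarith [hu.1]⟩
      refine this.congr (fun u hu ↦ ?_) ?_
      · simp [abs_of_neg (by linarith [hu.2] : u < 0)]
      · simp [abs_of_neg hv0]
    · have hvneg : v < 0 := by linarith [hv.2]
      exact hh'_off v (by rw [abs_of_neg hvneg]; linarith [hv.2]) (by rw [abs_of_neg hvneg]; linarith [hv.1])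
  -- splitting the integral
  have hint : ∀ a₁ a₂ : ℝ, -(1 / 2) ≤ a₁ → a₂ ≤ 1 / 2 → a₁ ≤ a₂ →
      IntervalIntegrable (fun v ↦ h v * exp (((Λ * v : ℝ) : ℂ) * I)) volume a₁ a₂ := by
    intro a₁ a₂ h1 h2 h12
    refine ContinuousOn.intervalIntegrable_of_Icc h12 ?_
    exact (hcont.mono (Icc_subset_Icc h1 h2)).mul (Continuous.continuousOn (by fun_prop))
  have hsplit : (∫ v in (-(1 / 2))..(1 / 2), h v * exp (((Λ * v : ℝ) : ℂ) * I)) -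
      (∫ v in (-r)..r, h v * exp (((Λ * v : ℝ) : ℂ) * I)) =
      (∫ v in (-(1 / 2))..(-r), h v * exp (((Λ * v : ℝ) : ℂ) * I)) +
        ∫ v in r..(1 / 2), h v * exp (((Λ * v : ℝ) : ℂ) * I) := by
    rw [← integral_add_adjacent_intervals (hint _ _ le_rfl (by linarith) (by linarith))
        (hint (-r) (1 / 2) (by linarith) le_rfl (by linarith)),
      ← integral_add_adjacent_intervals (hint (-r) r (by linarith) (by linarith) (by linarith))
        (hint r (1 / 2) (by linarith) le_rfl hr2)]
    ring
  rw [hsplit]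
  refine (norm_add_le _ _).trans ((add_le_add hLft hR).trans (le_of_eq ?_))
  field_simp
  ring

/-- **A whole piece `k ≠ 0` with a kernel factor** (trivial window `r = 1/Λ`):
`‖∫_{-1/2}^{1/2} h_k η e^{iΛv}‖ ≤ (MH/(Λ|k|))(40 Λ^{max(b̂(k),0)} + 48(L_k + 1) + 224)`.
[cite: Montgomery1983, §4 (21)] -/
theorem norm_gpiece_le (hA₃ : 0 ≤ A₃) (hA₄ : 0 ≤ A₄) {Λ : ℝ} (hΛ : 2 ≤ Λ) {α t : ℝ}
    (ht : |t| ≤ 1 / 4) {η η' : ℝ → ℂ} {H : ℝ} {k : ℤ} (hk : k ≠ 0)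
    (hηd : ∀ v ∈ Icc (-(1 / 2) : ℝ) (1 / 2), HasDerivAt η (η' v) v)
    (hηc : ContinuousOn η' (Icc (-(1 / 2)) (1 / 2)))
    (hηb : ∀ v ∈ Icc (-(1 / 2) : ℝ) (1 / 2), ‖η v‖ ≤ H)
    (hηb' : ∀ v ∈ Icc (-(1 / 2) : ℝ) (1 / 2), ‖η' v‖ ≤ H) :
    ‖∫ v in (-(1 / 2))..(1 / 2), gpiece m Λ α t η k v * exp (((Λ * v : ℝ) : ℂ) * I)‖ ≤
      Real.exp (A₁ + A₂ * Real.log (Real.log (|(k : ℝ)| + 5))) * H / (Λ * |(k : ℝ)|) *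
        (40 * Λ ^ (max (montgomeryCoeff m k) 0) + 48 * (A₃ + A₄ * Real.log (|(k : ℝ)| + 5) + 1) + 224) := by
  have hΛ0 : 0 < Λ := by linarith
  have hH : 0 ≤ H := le_trans (norm_nonneg _) (hηb 0 (by constructor <;> norm_num))
  set M := Real.exp (A₁ + A₂ * Real.log (Real.log (|(k : ℝ)| + 5))) with hM
  set L := A₃ + A₄ * Real.log (|(k : ℝ)| + 5) + 1 with hL
  set P := Λ ^ (max (montgomeryCoeff m k) 0) with hP
  have hM0 : 0 < M := Real.exp_pos _
  have hk0 : 0 < |(k : ℝ)| := by have := Int.one_le_abs hk; exact_mod_cast (show (0:ℤ) < |k| by omega)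
  have hP1 : 1 ≤ P := Real.one_le_rpow (by linarith) (le_max_right _ _)
  have hr1 : 1 / Λ ≤ 1 / Λ := le_rfl
  have hr2 : 1 / Λ ≤ 1 / 2 := one_div_le_one_div_of_le (by norm_num) hΛ
  have h1 := norm_gpiece_sub_window_le m h18 h19 hA₃ hA₄ hΛ (α := α) ht hk hr1 hr2 hηd hηc hηb hηb'
  have hrpow : (1 / Λ) ^ (-(max (montgomeryCoeff m k) 0)) = P := by
    rw [hP, Real.div_rpow zero_le_one hΛ0.le, Real.one_rpow, Real.rpow_neg hΛ0.le, one_div, inv_inv]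
  rw [hrpow] at h1
  have hvmem : ∀ v : ℝ, |v| ≤ 1 / 2 → v ∈ Icc (-(1 / 2) : ℝ) (1 / 2) := fun v hv ↦
    ⟨(abs_le.1 hv).1, (abs_le.1 hv).2⟩
  -- the window, trivially
  have hwin : ‖∫ v in (-(1 / Λ))..(1 / Λ), gpiece m Λ α t η k v * exp (((Λ * v : ℝ) : ℂ) * I)‖ ≤
      4 * M / |(k : ℝ)| * P * H * |1 / Λ - -(1 / Λ)| := by
    refine intervalIntegral.norm_integral_le_of_norm_le_const fun v hv ↦ ?_
    rw [uIoc_of_le (by linarith [one_div_pos.2 hΛ0]), mem_Ioc] at hv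
    rw [norm_mul, norm_exp_ofReal_mul_I, mul_one]
    have hv' : |v| ≤ 1 / 2 := abs_le.2 ⟨by linarith [hv.1, hr2], by linarith [hv.2]⟩
    exact norm_gpiece_le_window m h18 hΛ ht hk hv' (hηb v (hvmem v hv'))
  have hwin' : ‖∫ v in (-(1 / Λ))..(1 / Λ), gpiece m Λ α t η k v * exp (((Λ * v : ℝ) : ℂ) * I)‖ ≤
      8 * M * P * H / (Λ * |(k : ℝ)|) := by
    refine hwin.trans (le_of_eq ?_)
    have h2 : |1 / Λ - -(1 / Λ)| = 2 / Λ := by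
      rw [show (1 / Λ - -(1 / Λ) : ℝ) = 2 / Λ by ring, abs_of_pos (div_pos two_pos hΛ0)]
    rw [h2]
    field_simp
    ring
  calc ‖∫ v in (-(1 / 2))..(1 / 2), gpiece m Λ α t η k v * exp (((Λ * v : ℝ) : ℂ) * I)‖
      ≤ ‖(∫ v in (-(1 / 2))..(1 / 2), gpiece m Λ α t η k v * exp (((Λ * v : ℝ) : ℂ) * I)) -
          ∫ v in (-(1 / Λ))..(1 / Λ), gpiece m Λ α t η k v * exp (((Λ * v : ℝ) : ℂ) * I)‖ +
        ‖∫ v in (-(1 / Λ))..(1 / Λ), gpiece m Λ α t η k v * exp (((Λ * v : ℝ) : ℂ) * I)‖ :=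
          norm_le_norm_sub_add _ _
    _ ≤ 16 * M * H / (Λ * |(k : ℝ)|) * (2 * P + 3 * L + 14) + 8 * M * P * H / (Λ * |(k : ℝ)|) :=
        add_le_add h1 hwin'
    _ = M * H / (Λ * |(k : ℝ)|) * (40 * P + 48 * L + 224) := by field_simp; ring

/-! ## The piece `k = 1` with a kernel factor: the window carries the main term -/

omit h19 in
/-- `‖h₁(v)‖ |v| ≤ 8 M₁ |v|^{1−β}` for `0 < |v| ≤ 1/2` (`h₁ = pieceFun` with `c = 1`, `β = b̂(1)`,
`M₁ = e^{A₁+A₂ log log 6}`): off the window this is (21), on it `Λ^β |v| ≤ |v|^{1−β}`.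
[cite: Montgomery1983, §4 (21)] -/
theorem norm_pieceFun_one_mul_abs_le {Λ : ℝ} (hΛ : 2 ≤ Λ) {α t : ℝ} (ht : |t| ≤ 1 / 4) {v : ℝ}
    (hv0 : v ≠ 0) (hv2 : |v| ≤ 1 / 2) :
    ‖pieceFun m Λ α t 1 1 v‖ * |v| ≤
      8 * Real.exp (A₁ + A₂ * Real.log (Real.log 6)) * |v| ^ (1 - montgomeryCoeff m 1) := by
  have hΛ0 : 0 < Λ := by linarith
  set β := montgomeryCoeff m 1 with hβ
  have hβ0 : 0 ≤ β := by have := (montgomeryCoeff_one_bounds m).1; rw [hβ]; linarith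
  set M₁ := Real.exp (A₁ + A₂ * Real.log (Real.log 6)) with hM₁
  have hM₁0 : 0 < M₁ := Real.exp_pos _
  have habs : 0 < |v| := abs_pos.2 hv0
  have h6 : (|((1 : ℤ) : ℝ)| + 5 : ℝ) = 6 := by norm_num
  have hsplit : |v| ^ (1 - β) = |v| ^ (-β) * |v| := by
    rw [show 1 - β = -β + 1 by ring, Real.rpow_add habs, Real.rpow_one]
  rcases le_or_gt (1 / Λ) |v| with hv1 | hv1
  · have h := norm_pieceFun_le_off m h18 hΛ (α := α) ht (c := 1) (by simp) (k := 1) one_ne_zero hv1 hv2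
    rw [h6] at h
    simp only [Int.cast_one, abs_one, div_one] at h
    rw [hsplit, ← mul_assoc]
    exact mul_le_mul_of_nonneg_right h (abs_nonneg v)
  · have h := norm_pieceFun_le_window m h18 hΛ (α := α) ht (c := 1) (by simp) (k := 1) one_ne_zero hv2
    rw [h6, max_eq_left hβ0] at h
    simp only [Int.cast_one, abs_one, div_one] at h
    -- `Λ^β |v| ≤ |v|^{1-β}` since `Λ|v| ≤ 1`
    have hΛv : Λ * |v| ≤ 1 := ((lt_div_iff₀' hΛ0).1 hv1).le
    have hkey : Λ ^ β * |v| ≤ |v| ^ (1 - β) := by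
      rw [hsplit]
      have h1 : Λ ^ β * |v| ^ β ≤ 1 := by
        rw [← Real.mul_rpow hΛ0.le (abs_nonneg v)]
        exact Real.rpow_le_one (by positivity) hΛv hβ0
      have h2 : |v| ^ β * |v| ^ (-β) = 1 := by
        rw [← Real.rpow_add habs, add_neg_cancel, Real.rpow_zero]
      have h3 : Λ ^ β * |v| = (Λ ^ β * |v| ^ β) * (|v| ^ (-β) * |v|) := by
        calc Λ ^ β * |v| = Λ ^ β * (|v| ^ β * |v| ^ (-β)) * |v| := by rw [h2, mul_one]
          _ = _ := by ring
      calc Λ ^ β * |v| = (Λ ^ β * |v| ^ β) * (|v| ^ (-β) * |v|) := h3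
        _ ≤ 1 * (|v| ^ (-β) * |v|) := mul_le_mul_of_nonneg_right h1 (by positivity)
        _ = _ := one_mul _
    calc ‖pieceFun m Λ α t 1 1 v‖ * |v| ≤ (4 * M₁ * Λ ^ β) * |v| := mul_le_mul_of_nonneg_right h (abs_nonneg v)
      _ = 4 * M₁ * (Λ ^ β * |v|) := by ring
      _ ≤ 4 * M₁ * |v| ^ (1 - β) := mul_le_mul_of_nonneg_left hkey (by positivity)
      _ ≤ 8 * M₁ * |v| ^ (1 - β) := by nlinarith [Real.rpow_nonneg (abs_nonneg v) (1 - β)]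

/-- **The window about `1 + i` with a kernel factor carries the main term**: for `1/Λ ≤ w₀ ≤ 1/2`,
`L₁ w₀ ≤ 1`, `η` differentiable on `|v| ≤ 1/2` with `‖η'‖ ≤ H`,
`‖∫_{-w₀}^{w₀} h₁ η e^{iΛv} − (η(0) g₁(0)/(α+i(1−t))) ∫_{-w₀}^{w₀} (1/Λ+iv)^{-β} e^{iΛv}‖
  ≤ (‖η(0)‖(16L₁+32) + 16H) M₁ w₀^{2−β}` (freeze `η` at `v = 0`, then the sharp-kernel window lemma).
[cite: Montgomery1983, §4 (23)–(24)] -/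
theorem norm_gwindowOne_sub_main_le (hA₃ : 0 ≤ A₃) (hA₄ : 0 ≤ A₄) {Λ : ℝ} (hΛ : 2 ≤ Λ) {α t : ℝ}
    (ht : |t| ≤ 1 / 4) {η η' : ℝ → ℂ} {H : ℝ} {w₀ : ℝ} (hw1 : 1 / Λ ≤ w₀) (hw2 : w₀ ≤ 1 / 2)
    (hLw : (A₃ + A₄ * Real.log 6) * w₀ ≤ 1)
    (hηd : ∀ v ∈ Icc (-(1 / 2) : ℝ) (1 / 2), HasDerivAt η (η' v) v)
    (hηb' : ∀ v ∈ Icc (-(1 / 2) : ℝ) (1 / 2), ‖η' v‖ ≤ H) :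
    ‖(∫ v in (-w₀)..w₀, gpiece m Λ α t η 1 v * exp (((Λ * v : ℝ) : ℂ) * I)) -
        (η 0 * gOne m Λ 0 / ((α : ℂ) + ((1 - t : ℝ) : ℂ) * I)) *
          ∫ v in (-w₀)..w₀, (((1 / Λ : ℝ) : ℂ) + v * I) ^ (-(montgomeryCoeff m 1 : ℂ)) *
            exp (((Λ * v : ℝ) : ℂ) * I)‖ ≤
      (‖η 0‖ * (16 * (A₃ + A₄ * Real.log 6) + 32) + 16 * H) * Real.exp (A₁ + A₂ * Real.log (Real.log 6)) *
        w₀ ^ (2 - montgomeryCoeff m 1) := by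
  have hΛ0 : 0 < Λ := by linarith
  have hw0 : 0 < w₀ := (one_div_pos.2 hΛ0).trans_le hw1
  have hH : 0 ≤ H := le_trans (norm_nonneg _) (hηb' 0 (by constructor <;> norm_num))
  set β := montgomeryCoeff m 1 with hβ
  have hβ0 : 0 ≤ β := by have := (montgomeryCoeff_one_bounds m).1; rw [hβ]; linarith
  have hβ1 : β < 1 := (abs_lt.1 (abs_montgomeryCoeff_lt_one m 1)).2
  set L₁ := A₃ + A₄ * Real.log 6 with hL₁
  set M₁ := Real.exp (A₁ + A₂ * Real.log (Real.log 6)) with hM₁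
  have hM₁0 : 0 < M₁ := Real.exp_pos _
  set e : ℝ → ℂ := fun v ↦ exp (((Λ * v : ℝ) : ℂ) * I) with he
  have he1 : ∀ v, ‖e v‖ = 1 := fun v ↦ norm_exp_ofReal_mul_I _
  -- the sharp-kernel window lemma, with `c = 1`
  have hsharp := norm_windowOne_sub_main_le m h18 h19 hA₃ hA₄ hΛ (α := α) ht (c := 1) (by simp) hw1 hw2 hLw
  -- continuity / integrability
  have hsubI : Icc (-w₀) w₀ ⊆ Icc (-(1 / 2) : ℝ) (1 / 2) := Icc_subset_Icc (by linarith) hw2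
  have hpf : ContinuousOn (pieceFun m Λ α t 1 1) (Icc (-w₀) w₀) :=
    (continuousOn_pieceFun m hΛ (α := α) ht 1 (k := 1) one_ne_zero).1.mono hsubI
  have hηcont : ContinuousOn η (Icc (-w₀) w₀) := fun v hv ↦
    (hηd v (hsubI hv)).continuousAt.continuousWithinAt
  set F₁ : ℝ → ℂ := fun v ↦ pieceFun m Λ α t 1 1 v * η 0 * e v with hF₁
  set F₂ : ℝ → ℂ := fun v ↦ pieceFun m Λ α t 1 1 v * (η v - η 0) * e v with hF₂
  have hint₁ : IntervalIntegrable F₁ volume (-w₀) w₀ :=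
    ((hpf.mul continuousOn_const).mul (Continuous.continuousOn (by fun_prop))).intervalIntegrable_of_Icc
      (by linarith)
  have hint₂ : IntervalIntegrable F₂ volume (-w₀) w₀ :=
    ((hpf.mul (hηcont.sub continuousOn_const)).mul (Continuous.continuousOn (by fun_prop))).intervalIntegrable_of_Icc
      (by linarith)
  have hsplit : (∫ v in (-w₀)..w₀, gpiece m Λ α t η 1 v * e v) =
      η 0 * (∫ v in (-w₀)..w₀, pieceFun m Λ α t 1 1 v * e v) + ∫ v in (-w₀)..w₀, F₂ v := by
    rw [← intervalIntegral.integral_const_mul, ← intervalIntegral.integral_add (hint₁.congr ?_) hint₂]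
    · refine intervalIntegral.integral_congr fun v _ ↦ ?_
      simp only [gpiece, hF₂]; ring
    · exact fun v _ ↦ by simp only [hF₁]; ring
  -- the frozen part
  have hfrozen : ‖η 0 * (∫ v in (-w₀)..w₀, pieceFun m Λ α t 1 1 v * e v) -
      (η 0 * gOne m Λ 0 / ((α : ℂ) + ((1 - t : ℝ) : ℂ) * I)) *
        ∫ v in (-w₀)..w₀, (((1 / Λ : ℝ) : ℂ) + v * I) ^ (-(β : ℂ)) * e v‖ ≤
      ‖η 0‖ * ((16 * L₁ + 32) * M₁ * w₀ ^ (2 - β)) := by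
    have heq : η 0 * (∫ v in (-w₀)..w₀, pieceFun m Λ α t 1 1 v * e v) -
        (η 0 * gOne m Λ 0 / ((α : ℂ) + ((1 - t : ℝ) : ℂ) * I)) *
          ∫ v in (-w₀)..w₀, (((1 / Λ : ℝ) : ℂ) + v * I) ^ (-(β : ℂ)) * e v =
        η 0 * ((∫ v in (-w₀)..w₀, pieceFun m Λ α t 1 1 v * e v) -
          (gOne m Λ 0 * 1 / ((α : ℂ) + ((1 - t : ℝ) : ℂ) * I)) *
            ∫ v in (-w₀)..w₀, (((1 / Λ : ℝ) : ℂ) + v * I) ^ (-(β : ℂ)) * e v) := by ring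
    rw [heq, norm_mul]
    exact mul_le_mul_of_nonneg_left hsharp (norm_nonneg _)
  -- the variation part
  have hηvar : ∀ v ∈ Icc (-(1 / 2) : ℝ) (1 / 2), ‖η v - η 0‖ ≤ H * |v| := by
    intro v hv
    have := (convex_Icc (-(1 / 2) : ℝ) (1 / 2)).norm_image_sub_le_of_norm_hasDerivWithin_le
      (fun u hu ↦ (hηd u hu).hasDerivWithinAt) hηb'
      (show (0 : ℝ) ∈ Icc (-(1 / 2)) (1 / 2) by constructor <;> norm_num) hv
    simpa using this
  have hpt : ∀ v : ℝ, v ≠ 0 → |v| ≤ w₀ → ‖F₂ v‖ ≤ 8 * M₁ * H * |v| ^ (1 - β) := by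
    intro v hv0 hvw
    have hv2 : |v| ≤ 1 / 2 := hvw.trans hw2
    have hmem : v ∈ Icc (-(1 / 2) : ℝ) (1 / 2) := ⟨(abs_le.1 hv2).1, (abs_le.1 hv2).2⟩
    have h1 := norm_pieceFun_one_mul_abs_le m h18 hΛ (α := α) ht hv0 hv2
    simp only [hF₂, norm_mul, he1, mul_one]
    calc ‖pieceFun m Λ α t 1 1 v‖ * ‖η v - η 0‖ ≤ ‖pieceFun m Λ α t 1 1 v‖ * (H * |v|) :=
          mul_le_mul_of_nonneg_left (hηvar v hmem) (norm_nonneg _)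
      _ = (‖pieceFun m Λ α t 1 1 v‖ * |v|) * H := by ring
      _ ≤ (8 * M₁ * |v| ^ (1 - β)) * H := mul_le_mul_of_nonneg_right h1 hH
      _ = _ := by ring
  have hvarI : ‖∫ v in (-w₀)..w₀, F₂ v‖ ≤ ∫ v in (-w₀)..w₀, 8 * M₁ * H * |v| ^ (1 - β) := by
    refine intervalIntegral.norm_integral_le_of_norm_le (by linarith) ?_ ?_
    · filter_upwards [measure_eq_zero_iff_ae_notMem.1 (measure_singleton (0 : ℝ))] with v hv0 hv
      exact hpt v (fun h ↦ hv0 (by simp [h])) (abs_le.2 ⟨hv.1.le, hv.2⟩)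
    · exact ((Continuous.rpow_const (by fun_prop) fun _ ↦ Or.inr (by linarith)).const_mul _).intervalIntegrable _ _
  have hval : ∫ v in (-w₀)..w₀, 8 * M₁ * H * |v| ^ (1 - β) ≤ 16 * M₁ * H * w₀ ^ (2 - β) := by
    rw [intervalIntegral.integral_const_mul, integral_abs_rpow_symm hw0.le (by linarith),
      show 1 - β + 1 = 2 - β by ring]
    have hpos : 0 ≤ w₀ ^ (2 - β) := Real.rpow_nonneg hw0.le _
    rw [show 8 * M₁ * H * (2 * w₀ ^ (2 - β) / (2 - β)) = 16 * M₁ * H * w₀ ^ (2 - β) / (2 - β) by ring,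
      div_le_iff₀ (by linarith)]
    nlinarith [mul_nonneg (mul_nonneg hM₁0.le hH) hpos]
  -- assemble
  rw [hsplit]
  calc ‖η 0 * (∫ v in (-w₀)..w₀, pieceFun m Λ α t 1 1 v * e v) + (∫ v in (-w₀)..w₀, F₂ v) -
        (η 0 * gOne m Λ 0 / ((α : ℂ) + ((1 - t : ℝ) : ℂ) * I)) *
          ∫ v in (-w₀)..w₀, (((1 / Λ : ℝ) : ℂ) + v * I) ^ (-(β : ℂ)) * e v‖
      = ‖(η 0 * (∫ v in (-w₀)..w₀, pieceFun m Λ α t 1 1 v * e v) -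
          (η 0 * gOne m Λ 0 / ((α : ℂ) + ((1 - t : ℝ) : ℂ) * I)) *
            ∫ v in (-w₀)..w₀, (((1 / Λ : ℝ) : ℂ) + v * I) ^ (-(β : ℂ)) * e v) + ∫ v in (-w₀)..w₀, F₂ v‖ := by
        ring_nf
    _ ≤ ‖η 0‖ * ((16 * L₁ + 32) * M₁ * w₀ ^ (2 - β)) + 16 * M₁ * H * w₀ ^ (2 - β) :=
        (norm_add_le _ _).trans (add_le_add hfrozen (hvarI.trans hval))
    _ = _ := by ring

/-! ## The piece `k = 0` with a kernel factor -/

/-- **The piece `k = 0` with a kernel factor is small** (`a = |α|/2`, `|t| ≤ a`, `1/Λ ≤ a ≤ 1/2`,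
`|η|, |η'| ≤ H` on the piece; `β₀ = −b̂(0)`, `M₀ = e^{A₁+A₂ log log 5}`, `L₀ = A₃ + A₄ log 5`):
`‖∫_{-1/2}^{1/2} h₀ η e^{iΛv}‖ ≤ H (4M₀(2/Λ)^{β₀}/(Λa) + (8M₀/Λ)(Λ^{-β₀}/a + 2 + a^{β₀−1}(3 + 3/(1−β₀)) + (L₀+1)/β₀))`.
[cite: Montgomery1983, §4 (the contribution of the neighbourhood of `w = 1 − s`)] -/
theorem norm_gpieceZero_le (hA₃ : 0 ≤ A₃) (hA₄ : 0 ≤ A₄) {Λ : ℝ} (hΛ : 2 ≤ Λ) {α t : ℝ} (hα : α ≠ 0)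
    (ht : |t| ≤ |α| / 2) {η η' : ℝ → ℂ} {H : ℝ} (ha1 : 1 / Λ ≤ |α| / 2) (ha2 : |α| / 2 ≤ 1 / 2)
    (hηd : ∀ v ∈ Icc (-(1 / 2) : ℝ) (1 / 2), HasDerivAt η (η' v) v)
    (hηc : ContinuousOn η' (Icc (-(1 / 2)) (1 / 2)))
    (hηb : ∀ v ∈ Icc (-(1 / 2) : ℝ) (1 / 2), ‖η v‖ ≤ H)
    (hηb' : ∀ v ∈ Icc (-(1 / 2) : ℝ) (1 / 2), ‖η' v‖ ≤ H) :
    ‖∫ v in (-(1 / 2))..(1 / 2), gpiece m Λ α t η 0 v * exp (((Λ * v : ℝ) : ℂ) * I)‖ ≤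
      H * (4 * Real.exp (A₁ + A₂ * Real.log (Real.log 5)) * (2 / Λ) ^ (-montgomeryCoeff m 0) / (Λ * (|α| / 2)) +
      8 * Real.exp (A₁ + A₂ * Real.log (Real.log 5)) / Λ *
        (Λ ^ (montgomeryCoeff m 0) / (|α| / 2) + 2 +
          (|α| / 2) ^ (-montgomeryCoeff m 0 - 1) * (3 + 3 / (1 - -montgomeryCoeff m 0)) +
          (A₃ + A₄ * Real.log 5 + 1) / (-montgomeryCoeff m 0))) := by
  have hΛ0 : 0 < Λ := by linarith
  have hH : 0 ≤ H := le_trans (norm_nonneg _) (hηb 0 (by constructor <;> norm_num))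
  set β₀ := -montgomeryCoeff m 0 with hβ₀
  have hβ₀0 : 0 < β₀ := by rw [hβ₀]; linarith [(montgomeryCoeff_zero_bounds m).2]
  have hβ₀1 : β₀ < 1 := by rw [hβ₀]; linarith [(montgomeryCoeff_zero_bounds m).1]
  set M₀ := Real.exp (A₁ + A₂ * Real.log (Real.log 5)) with hM₀
  set L₀ := A₃ + A₄ * Real.log 5 + 1 with hL₀
  have hM₀0 : 0 < M₀ := Real.exp_pos _
  have hL₀0 : 0 ≤ L₀ := add_nonneg (add_nonneg hA₃ (mul_nonneg hA₄ (Real.log_nonneg (by norm_num)))) zero_le_one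
  set a := |α| / 2 with ha
  have ha0 : 0 < a := by rw [ha]; exact div_pos (abs_pos.2 hα) two_pos
  have hr0 : 0 < 1 / Λ := one_div_pos.2 hΛ0
  have hr2 : 1 / Λ ≤ 1 / 2 := ha1.trans ha2
  have hvmem : ∀ v : ℝ, |v| ≤ 1 / 2 → v ∈ Icc (-(1 / 2) : ℝ) (1 / 2) := fun v hv ↦
    ⟨(abs_le.1 hv).1, (abs_le.1 hv).2⟩
  set h : ℝ → ℂ := gpiece m Λ α t η 0 with hh
  set h' : ℝ → ℂ := fun v ↦ (I * 1 * (deriv (montgomeryF m) (zline Λ ((0 : ℤ) + v)) /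
      ((α : ℂ) + ((((0 : ℤ) : ℝ) + v - t : ℝ) : ℂ) * I) -
      montgomeryF m (zline Λ ((0 : ℤ) + v)) / ((α : ℂ) + ((((0 : ℤ) : ℝ) + v - t : ℝ) : ℂ) * I) ^ 2)) * η v +
      pieceFun m Λ α t 1 0 v * η' v with hh'
  obtain ⟨hpfc, hpfc'⟩ := continuousOn_pieceFun_zero m hΛ hα ht 1
  have hηcont : ContinuousOn η (Icc (-(1 / 2)) (1 / 2)) :=
    fun v hv ↦ (hηd v hv).continuousAt.continuousWithinAt
  have hcont : ContinuousOn h (Icc (-(1 / 2)) (1 / 2)) := hpfc.continuousOn.mul hηcont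
  have hcont' : ContinuousOn h' (Icc (-(1 / 2)) (1 / 2)) :=
    (hpfc'.continuousOn.mul hηcont).add (hpfc.continuousOn.mul hηc)
  have hderiv : ∀ v : ℝ, |v| ≤ 1 / 2 → HasDerivAt h (h' v) v := fun v hv ↦
    (hasDerivAt_pieceFun_zero m hΛ hα ht 1 v).mul (hηd v (hvmem v hv))
  have hB := fun v (hv : |v| ≤ 1 / 2) ↦ norm_pieceFun_zero_le m h18 h19 hA₃ hA₄ hΛ hα ht (c := 1) (by simp) hv
  -- pointwise bounds for `h` and `h'`
  have hh_win : ∀ v : ℝ, |v| ≤ 1 / Λ → ‖h v‖ ≤ 2 * M₀ * (2 / Λ) ^ β₀ / a * H := by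
    intro v hv1
    have hv2 : |v| ≤ 1 / 2 := hv1.trans hr2
    have := (hB v hv2).1 hv1
    rw [← hβ₀, ← hM₀, ← ha] at this
    simp only [hh, gpiece, norm_mul]
    exact mul_le_mul this (hηb v (hvmem v hv2)) (norm_nonneg _) (by positivity)
  have hh_off : ∀ v : ℝ, 1 / Λ ≤ |v| → |v| ≤ 1 / 2 → ‖h v‖ ≤ 4 * M₀ * |v| ^ β₀ / (a + |v|) * H := by
    intro v hv1 hv2
    have := (hB v hv2).2.1 hv1
    rw [← hβ₀, ← hM₀, ← ha] at this
    simp only [hh, gpiece, norm_mul]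
    exact mul_le_mul this (hηb v (hvmem v hv2)) (norm_nonneg _) (by positivity)
  set g : ℝ → ℝ := fun v ↦ 4 * (M₀ * H) * (β₀ * v ^ (β₀ - 1) / (a + v) + L₀ * v ^ β₀ / (a + v) +
    2 * v ^ β₀ / (a + v) ^ 2) with hg
  have hh'_off : ∀ v : ℝ, 1 / Λ ≤ |v| → |v| ≤ 1 / 2 → ‖h' v‖ ≤ g |v| := by
    intro v hv1 hv2
    have hD := (hB v hv2).2.2 hv1
    have hF := (hB v hv2).2.1 hv1
    rw [← hβ₀, ← hM₀, ← ha] at hD hF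
    have hηv := hηb v (hvmem v hv2)
    have hη'v := hηb' v (hvmem v hv2)
    have hvb : 0 ≤ |v| ^ β₀ := Real.rpow_nonneg (abs_nonneg v) _
    have hav : 0 < a + |v| := by linarith [abs_nonneg v]
    simp only [hh']
    calc ‖(I * 1 * (deriv (montgomeryF m) (zline Λ ((0 : ℤ) + v)) /
            ((α : ℂ) + ((((0 : ℤ) : ℝ) + v - t : ℝ) : ℂ) * I) -
            montgomeryF m (zline Λ ((0 : ℤ) + v)) / ((α : ℂ) + ((((0 : ℤ) : ℝ) + v - t : ℝ) : ℂ) * I) ^ 2)) * η v +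
            pieceFun m Λ α t 1 0 v * η' v‖
        ≤ ‖I * 1 * (deriv (montgomeryF m) (zline Λ ((0 : ℤ) + v)) /
            ((α : ℂ) + ((((0 : ℤ) : ℝ) + v - t : ℝ) : ℂ) * I) -
            montgomeryF m (zline Λ ((0 : ℤ) + v)) / ((α : ℂ) + ((((0 : ℤ) : ℝ) + v - t : ℝ) : ℂ) * I) ^ 2)‖ * ‖η v‖ +
            ‖pieceFun m Λ α t 1 0 v‖ * ‖η' v‖ :=
          (norm_add_le _ _).trans (add_le_add (norm_mul_le _ _) (norm_mul_le _ _))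
      _ ≤ (4 * M₀ * (β₀ * |v| ^ (β₀ - 1) / (a + |v|) + (A₃ + A₄ * Real.log 5) * |v| ^ β₀ / (a + |v|) +
            2 * |v| ^ β₀ / (a + |v|) ^ 2)) * H + (4 * M₀ * |v| ^ β₀ / (a + |v|)) * H := by
          refine add_le_add (mul_le_mul hD hηv (norm_nonneg _) (le_trans (norm_nonneg _) hD))
            (mul_le_mul hF hη'v (norm_nonneg _) (le_trans (norm_nonneg _) hF))
      _ = g |v| := by simp only [hg, hL₀]; ring
  have hIg : ∫ v in (1 / Λ)..(1 / 2), g v ≤ 4 * (M₀ * H) * (a ^ (β₀ - 1) * (3 + 3 / (1 - β₀)) + L₀ / β₀) :=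
    integral_pieceZeroBound_le (mul_nonneg hM₀0.le hH) hL₀0 hβ₀0 hβ₀1 hr0 ha1 ha2
  have hg_cont : ContinuousOn g (Icc (1 / Λ) (1 / 2)) := by
    intro v hv
    have hv0 : 0 < v := hr0.trans_le hv.1
    simp only [hg]
    refine (continuousAt_const.mul ((ContinuousAt.add (ContinuousAt.add ?_ ?_) ?_))).continuousWithinAt
    · exact (continuousAt_const.mul (Real.continuousAt_rpow_const _ _ (Or.inl hv0.ne'))).div (by fun_prop) (by linarith)
    · exact (continuousAt_const.mul (Real.continuousAt_rpow_const _ _ (Or.inl hv0.ne'))).div (by fun_prop) (by linarith)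
    · exact (continuousAt_const.mul (Real.continuousAt_rpow_const _ _ (Or.inl hv0.ne'))).div (by fun_prop) (by positivity)
  -- boundary values
  have hbd_r : ∀ v : ℝ, |v| = 1 / Λ → ‖h v‖ ≤ 4 * M₀ * Λ ^ (-β₀) / a * H := by
    intro v hv
    have := hh_off v (by rw [hv]) (by rw [hv]; exact hr2)
    rw [hv] at this
    refine this.trans (mul_le_mul_of_nonneg_right ?_ hH)
    rw [Real.div_rpow zero_le_one hΛ0.le, Real.one_rpow, one_div (Λ ^ β₀), ← Real.rpow_neg hΛ0.le]
    exact div_le_div_of_nonneg_left (by positivity) ha0 (by linarith)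
  have hbd_half : ∀ v : ℝ, |v| = 1 / 2 → ‖h v‖ ≤ 8 * M₀ * H := by
    intro v hv
    have := hh_off v (by rw [hv]; exact hr2) (by rw [hv])
    rw [hv] at this
    refine this.trans ?_
    have h1 : (1 / 2 : ℝ) ^ β₀ ≤ 1 := Real.rpow_le_one (by norm_num) (by norm_num) hβ₀0.le
    have h2 : 4 * M₀ * (1 / 2 : ℝ) ^ β₀ / (a + 1 / 2) ≤ 8 * M₀ := by
      rw [div_le_iff₀ (by linarith)]; nlinarith
    exact mul_le_mul_of_nonneg_right h2 hH
  -- right side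
  have hR : ‖∫ v in (1 / Λ)..(1 / 2), h v * exp (((Λ * v : ℝ) : ℂ) * I)‖ ≤
      (4 * M₀ * Λ ^ (-β₀) / a * H + 8 * M₀ * H + 4 * (M₀ * H) * (a ^ (β₀ - 1) * (3 + 3 / (1 - β₀)) + L₀ / β₀)) / Λ := by
    have hsub : Icc (1 / Λ) (1 / 2) ⊆ Icc (-(1 / 2) : ℝ) (1 / 2) := Icc_subset_Icc (by linarith) le_rfl
    refine (norm_integral_mul_exp_le hr2 hΛ0 (fun v hv ↦ hderiv v (abs_le.2 ⟨by linarith [hv.1], hv.2⟩))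
      (hcont'.mono hsub)).trans ?_
    refine div_le_div_of_nonneg_right (add_le_add (add_le_add (hbd_r _ (abs_of_pos hr0))
      (hbd_half (1 / 2) (abs_of_pos (by norm_num)))) ?_) hΛ0.le
    refine le_trans (intervalIntegral.integral_mono_on hr2 ?_ (hg_cont.intervalIntegrable_of_Icc hr2)
      fun v hv ↦ ?_) hIg
    · exact ((hcont'.mono hsub).norm).intervalIntegrable_of_Icc hr2
    · have hv0 : 0 < v := hr0.trans_le hv.1
      have := hh'_off v (by rw [abs_of_pos hv0]; exact hv.1) (by rw [abs_of_pos hv0]; exact hv.2)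
      rwa [abs_of_pos hv0] at this
  -- left side
  have hLft : ‖∫ v in (-(1 / 2))..(-(1 / Λ)), h v * exp (((Λ * v : ℝ) : ℂ) * I)‖ ≤
      (8 * M₀ * H + 4 * M₀ * Λ ^ (-β₀) / a * H + 4 * (M₀ * H) * (a ^ (β₀ - 1) * (3 + 3 / (1 - β₀)) + L₀ / β₀)) / Λ := by
    have hle : -(1 / 2 : ℝ) ≤ -(1 / Λ) := by linarith
    have hsub : Icc (-(1 / 2) : ℝ) (-(1 / Λ)) ⊆ Icc (-(1 / 2) : ℝ) (1 / 2) := Icc_subset_Icc le_rfl (by linarith)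
    refine (norm_integral_mul_exp_le hle hΛ0 (fun v hv ↦ hderiv v (abs_le.2 ⟨hv.1, by linarith [hv.2]⟩))
      (hcont'.mono hsub)).trans ?_
    refine div_le_div_of_nonneg_right (add_le_add (add_le_add
      (hbd_half _ (by rw [abs_neg, abs_of_pos (by norm_num)]))
      (hbd_r _ (by rw [abs_neg, abs_of_pos hr0]))) ?_) hΛ0.le
    have hcomp : ∫ v in (-(1 / 2))..(-(1 / Λ)), g |v| = ∫ v in (1 / Λ)..(1 / 2), g v := by
      rw [← intervalIntegral.integral_comp_neg]
      refine intervalIntegral.integral_congr fun v hv ↦ ?_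
      rw [uIcc_of_le hr2] at hv
      simp [abs_neg, abs_of_pos (hr0.trans_le hv.1)]
    refine le_trans (intervalIntegral.integral_mono_on hle ?_ ?_ fun v hv ↦ ?_) (hcomp ▸ hIg)
    · exact ((hcont'.mono hsub).norm).intervalIntegrable_of_Icc hle
    · refine ContinuousOn.intervalIntegrable_of_Icc hle ?_
      intro v hv
      have hv0 : v < 0 := by linarith [hv.2]
      have : ContinuousWithinAt (fun v : ℝ ↦ g (-v)) (Icc (-(1 / 2)) (-(1 / Λ))) v := by
        refine ((hg_cont (-v) ⟨by linarith [hv.2], by linarith [hv.1]⟩).comp continuous_neg.continuousWithinAt ?_)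
        intro u hu; exact ⟨by linarith [hu.2], by linarith [hu.1]⟩
      refine this.congr (fun u hu ↦ ?_) ?_
      · simp [abs_of_neg (by linarith [hu.2] : u < 0)]
      · simp [abs_of_neg hv0]
    · have hvneg : v < 0 := by linarith [hv.2]
      have hva : |v| = -v := abs_of_neg hvneg
      exact hh'_off v (by rw [hva]; linarith [hv.2]) (by rw [hva]; linarith [hv.1])
  -- window
  have hwin : ‖∫ v in (-(1 / Λ))..(1 / Λ), h v * exp (((Λ * v : ℝ) : ℂ) * I)‖ ≤
      2 * M₀ * (2 / Λ) ^ β₀ / a * H * |1 / Λ - -(1 / Λ)| := by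
    refine intervalIntegral.norm_integral_le_of_norm_le_const fun v hv ↦ ?_
    rw [uIoc_of_le (by linarith), mem_Ioc] at hv
    rw [norm_mul, norm_exp_ofReal_mul_I, mul_one]
    exact hh_win v (abs_le.2 ⟨hv.1.le, hv.2⟩)
  have hwin' : ‖∫ v in (-(1 / Λ))..(1 / Λ), h v * exp (((Λ * v : ℝ) : ℂ) * I)‖ ≤
      4 * M₀ * (2 / Λ) ^ β₀ / (Λ * a) * H := by
    refine hwin.trans (le_of_eq ?_)
    have h2 : |1 / Λ - -(1 / Λ)| = 2 / Λ := by
      rw [show (1 / Λ - -(1 / Λ) : ℝ) = 2 / Λ by ring, abs_of_pos (div_pos two_pos hΛ0)]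
    rw [h2]; field_simp; ring
  -- split
  have hint : ∀ a₁ a₂ : ℝ, -(1 / 2) ≤ a₁ → a₂ ≤ 1 / 2 → a₁ ≤ a₂ →
      IntervalIntegrable (fun v ↦ h v * exp (((Λ * v : ℝ) : ℂ) * I)) volume a₁ a₂ := by
    intro a₁ a₂ h1 h2 h12
    refine ContinuousOn.intervalIntegrable_of_Icc h12 ?_
    exact (hcont.mono (Icc_subset_Icc h1 h2)).mul (Continuous.continuousOn (by fun_prop))
  have hsplit : (∫ v in (-(1 / 2))..(1 / 2), h v * exp (((Λ * v : ℝ) : ℂ) * I)) =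
      (∫ v in (-(1 / 2))..(-(1 / Λ)), h v * exp (((Λ * v : ℝ) : ℂ) * I)) +
      (∫ v in (-(1 / Λ))..(1 / Λ), h v * exp (((Λ * v : ℝ) : ℂ) * I)) +
        ∫ v in (1 / Λ)..(1 / 2), h v * exp (((Λ * v : ℝ) : ℂ) * I) := by
    rw [integral_add_adjacent_intervals (hint _ _ le_rfl (by linarith) (by linarith))
        (hint _ _ (by linarith) (by linarith) (by linarith)),
      integral_add_adjacent_intervals (hint _ _ le_rfl (by linarith) (by linarith)) (hint _ _ (by linarith) le_rfl hr2)]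
  rw [hsplit]
  refine (norm_add₃_le).trans ?_
  refine (add_le_add (add_le_add hLft hwin') hR).trans (le_of_eq ?_)
  have hb : Λ ^ (-β₀) = Λ ^ (montgomeryCoeff m 0) := by rw [hβ₀, neg_neg]
  rw [hb]
  ring

/-! ## Summing the pieces `k ∉ {0, 1}` (with kernel factors) -/

/-- **The pieces `k ∉ {0,1}` with kernel factors add up to little**: for a family of factors `η_k`
with `|η_k|, |η_k'| ≤ H` on `|v| ≤ 1/2`, with `M_* = e^{A₁ + A₂ log log(K₀+5)}`, `L_* = A₃ + A₄ log(K₀+5)`,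
`Σ_{|k| ≤ K₀, k ≠ 0, 1} ‖∫ h_k η_k e^{iΛv}‖ ≤ (M_* H/Λ)(40Λ^{1/3} + 48(L_*+1) + 224) · 2(1 + log K₀)`.
[cite: Montgomery1983, §4 (22)] -/
theorem sum_norm_gpieces_le (hA₂ : 0 ≤ A₂) (hA₃ : 0 ≤ A₃) (hA₄ : 0 ≤ A₄) {Λ : ℝ} (hΛ : 2 ≤ Λ) {α t : ℝ}
    (ht : |t| ≤ 1 / 4) (η η' : ℤ → ℝ → ℂ) {H : ℝ} (hH : 0 ≤ H)
    (hηd : ∀ k, ∀ v ∈ Icc (-(1 / 2) : ℝ) (1 / 2), HasDerivAt (η k) (η' k v) v)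
    (hηc : ∀ k, ContinuousOn (η' k) (Icc (-(1 / 2)) (1 / 2)))
    (hηb : ∀ k, ∀ v ∈ Icc (-(1 / 2) : ℝ) (1 / 2), ‖η k v‖ ≤ H)
    (hηb' : ∀ k, ∀ v ∈ Icc (-(1 / 2) : ℝ) (1 / 2), ‖η' k v‖ ≤ H) (K₀ : ℕ) :
    ∑ i ∈ (Finset.range (2 * K₀ + 1)).filter (fun i ↦ i ≠ K₀ ∧ i ≠ K₀ + 1),
      ‖∫ v in (-(1 / 2))..(1 / 2), gpiece m Λ α t (η ((i : ℤ) - K₀)) ((i : ℤ) - K₀) v *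
        exp (((Λ * v : ℝ) : ℂ) * I)‖ ≤
      Real.exp (A₁ + A₂ * Real.log (Real.log ((K₀ : ℝ) + 5))) * H / Λ *
        (40 * Λ ^ (1 / 3 : ℝ) + 48 * (A₃ + A₄ * Real.log ((K₀ : ℝ) + 5) + 1) + 224) * (2 * (1 + Real.log K₀)) := by
  have hΛ0 : 0 < Λ := by linarith
  set M := Real.exp (A₁ + A₂ * Real.log (Real.log ((K₀ : ℝ) + 5))) with hM
  set L := A₃ + A₄ * Real.log ((K₀ : ℝ) + 5) + 1 with hL
  have hL0 : 0 ≤ L := add_nonneg (add_nonneg hA₃ (mul_nonneg hA₄ (Real.log_nonneg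
    (by linarith [(Nat.cast_nonneg K₀ : (0:ℝ) ≤ K₀)])))) zero_le_one
  set Q := M * H / Λ * (40 * Λ ^ (1 / 3 : ℝ) + 48 * L + 224) with hQ
  have hQ0 : 0 ≤ Q := by positivity
  have hterm : ∀ i ∈ (Finset.range (2 * K₀ + 1)).filter (fun i ↦ i ≠ K₀ ∧ i ≠ K₀ + 1),
      ‖∫ v in (-(1 / 2))..(1 / 2), gpiece m Λ α t (η ((i : ℤ) - K₀)) ((i : ℤ) - K₀) v *
        exp (((Λ * v : ℝ) : ℂ) * I)‖ ≤ Q * (1 / |(i : ℝ) - K₀|) := by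
    intro i hi
    simp only [Finset.mem_filter, Finset.mem_range] at hi
    set k : ℤ := (i : ℤ) - K₀ with hk
    have hk0 : k ≠ 0 := by omega
    have hk1 : k ≠ 1 := by omega
    have hkK' : |k| ≤ (K₀ : ℤ) := by rw [hk, abs_le]; omega
    have hkK : |(k : ℝ)| ≤ K₀ := by exact_mod_cast hkK'
    have hkR : |(i : ℝ) - K₀| = |(k : ℝ)| := by rw [hk]; push_cast; ring_nf
    refine (norm_gpiece_le m h18 h19 hA₃ hA₄ hΛ ht hk0 (hηd k) (hηc k) (hηb k) (hηb' k)).trans ?_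
    have hlog : Real.log (|(k : ℝ)| + 5) ≤ Real.log ((K₀ : ℝ) + 5) :=
      Real.log_le_log (by linarith [abs_nonneg (k : ℝ)]) (by linarith)
    have hMk : Real.exp (A₁ + A₂ * Real.log (Real.log (|(k : ℝ)| + 5))) ≤ M := by
      refine Real.exp_le_exp.2 (add_le_add le_rfl (mul_le_mul_of_nonneg_left ?_ hA₂))
      exact Real.log_le_log (by linarith [one_le_log_abs_add_five (k : ℝ)]) hlog
    have hLk : A₃ + A₄ * Real.log (|(k : ℝ)| + 5) + 1 ≤ L :=
      add_le_add (add_le_add le_rfl (mul_le_mul_of_nonneg_left hlog hA₄)) le_rfl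
    have hb : max (montgomeryCoeff m k) 0 ≤ 1 / 3 :=
      max_le ((le_abs_self _).trans (abs_montgomeryCoeff_le_third m hk0 hk1)) (by norm_num)
    have hP : Λ ^ (max (montgomeryCoeff m k) 0) ≤ Λ ^ (1 / 3 : ℝ) :=
      Real.rpow_le_rpow_of_exponent_le (by linarith) hb
    have hkpos : 0 < |(k : ℝ)| := abs_pos.2 (by exact_mod_cast hk0)
    rw [hkR]
    have hLk0 : 0 ≤ A₃ + A₄ * Real.log (|(k : ℝ)| + 5) + 1 :=
      add_nonneg (add_nonneg hA₃ (mul_nonneg hA₄ ((one_le_log_abs_add_five _).trans' zero_le_one))) zero_le_one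
    have hP0 : 0 ≤ Λ ^ (max (montgomeryCoeff m k) 0) := Real.rpow_nonneg hΛ0.le _
    calc Real.exp (A₁ + A₂ * Real.log (Real.log (|(k : ℝ)| + 5))) * H / (Λ * |(k : ℝ)|) *
          (40 * Λ ^ (max (montgomeryCoeff m k) 0) + 48 * (A₃ + A₄ * Real.log (|(k : ℝ)| + 5) + 1) + 224)
        ≤ M * H / (Λ * |(k : ℝ)|) * (40 * Λ ^ (1 / 3 : ℝ) + 48 * L + 224) := by
          refine mul_le_mul (div_le_div_of_nonneg_right (mul_le_mul_of_nonneg_right hMk hH) (by positivity))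
            (by linarith) (by positivity) (by positivity)
      _ = Q * (1 / |(k : ℝ)|) := by simp only [hQ]; field_simp
  refine (Finset.sum_le_sum hterm).trans ?_
  rw [← Finset.mul_sum]
  refine mul_le_mul_of_nonneg_left ?_ hQ0
  calc ∑ i ∈ (Finset.range (2 * K₀ + 1)).filter (fun i ↦ i ≠ K₀ ∧ i ≠ K₀ + 1), 1 / |(i : ℝ) - K₀|
      ≤ ∑ i ∈ (Finset.range (2 * K₀ + 1)).filter (fun i ↦ i ≠ K₀), 1 / |(i : ℝ) - K₀| := by
        refine Finset.sum_le_sum_of_subset_of_nonneg (fun i hi ↦ ?_) fun i _ _ ↦ by positivity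
        simp only [Finset.mem_filter] at hi ⊢
        exact ⟨hi.1, hi.2.1⟩
    _ ≤ 2 * (1 + Real.log K₀) := sum_inv_abs_sub_le K₀

/-! ## All the pieces together: the main term of the line integral -/

/-- **The line integral with a kernel factor, all pieces together.** With `β = b̂(1)`,
`M₁ = e^{A₁+A₂ log log 6}`, `L₁ = A₃ + A₄ log 6`, a window `1/Λ ≤ w₀ ≤ 1/2` with `L₁w₀ ≤ 1`, the piece-`0`
conditions `|t| ≤ |α|/2`, `1/Λ ≤ |α|/2 ≤ 1/2`, `|t| ≤ 1/4`, and kernel factors `η_k` with `|η_k|, |η_k'| ≤ H`: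
`Σ_{|k| ≤ K₀} ∫_{-1/2}^{1/2} h_k η_k e^{iΛv} = η₁(0) g₁(0)/(α + i(1−t)) · Λ^{β−1} e^{-1} · 2π/Γ(β) + Err`, where
`Err` collects the pieces `k ∉ {0,1}` ((22)), the piece `k = 0`, the flanks and the freezing error of the
piece `k = 1`, and the truncation `O((Λw₀)^{-β})` of Hankel's integral ((23)–(24)).
[cite: Montgomery1983, §4 (20)–(24)] -/
theorem norm_sum_gpieces_sub_main_le (hA₂ : 0 ≤ A₂) (hA₃ : 0 ≤ A₃) (hA₄ : 0 ≤ A₄) {Λ : ℝ} (hΛ : 2 ≤ Λ)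
    {α t : ℝ} (hα : α ≠ 0) (ht4 : |t| ≤ 1 / 4) (htα : |t| ≤ |α| / 2) (ha1 : 1 / Λ ≤ |α| / 2)
    (ha2 : |α| / 2 ≤ 1 / 2) {w₀ : ℝ} (hw1 : 1 / Λ ≤ w₀) (hw2 : w₀ ≤ 1 / 2)
    (hLw : (A₃ + A₄ * Real.log 6) * w₀ ≤ 1) (η η' : ℤ → ℝ → ℂ) {H : ℝ} (hH : 0 ≤ H)
    (hηd : ∀ k, ∀ v ∈ Icc (-(1 / 2) : ℝ) (1 / 2), HasDerivAt (η k) (η' k v) v)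
    (hηc : ∀ k, ContinuousOn (η' k) (Icc (-(1 / 2)) (1 / 2)))
    (hηb : ∀ k, ∀ v ∈ Icc (-(1 / 2) : ℝ) (1 / 2), ‖η k v‖ ≤ H)
    (hηb' : ∀ k, ∀ v ∈ Icc (-(1 / 2) : ℝ) (1 / 2), ‖η' k v‖ ≤ H) {K₀ : ℕ} (hK₀ : 1 ≤ K₀) :
    ‖(∑ i ∈ Finset.range (2 * K₀ + 1), ∫ v in (-(1 / 2))..(1 / 2),
        gpiece m Λ α t (η ((i : ℤ) - K₀)) ((i : ℤ) - K₀) v * exp (((Λ * v : ℝ) : ℂ) * I)) -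
      η 1 0 * gOne m Λ 0 / ((α : ℂ) + ((1 - t : ℝ) : ℂ) * I) *
        (((Λ ^ (montgomeryCoeff m 1 - 1) * Real.exp (-1) : ℝ) : ℂ) *
          ((2 * Real.pi / Real.Gamma (montgomeryCoeff m 1) : ℝ) : ℂ))‖ ≤
      Real.exp (A₁ + A₂ * Real.log (Real.log ((K₀ : ℝ) + 5))) * H / Λ *
          (40 * Λ ^ (1 / 3 : ℝ) + 48 * (A₃ + A₄ * Real.log ((K₀ : ℝ) + 5) + 1) + 224) * (2 * (1 + Real.log K₀)) +
        H * (4 * Real.exp (A₁ + A₂ * Real.log (Real.log 5)) * (2 / Λ) ^ (-montgomeryCoeff m 0) / (Λ * (|α| / 2)) +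
          8 * Real.exp (A₁ + A₂ * Real.log (Real.log 5)) / Λ *
            (Λ ^ (montgomeryCoeff m 0) / (|α| / 2) + 2 +
              (|α| / 2) ^ (-montgomeryCoeff m 0 - 1) * (3 + 3 / (1 - -montgomeryCoeff m 0)) +
              (A₃ + A₄ * Real.log 5 + 1) / (-montgomeryCoeff m 0))) +
        16 * Real.exp (A₁ + A₂ * Real.log (Real.log 6)) * H / Λ *
          (2 * w₀ ^ (-montgomeryCoeff m 1) + 3 * (A₃ + A₄ * Real.log 6 + 1) + 14) +
        (H * (16 * (A₃ + A₄ * Real.log 6) + 32) + 16 * H) * Real.exp (A₁ + A₂ * Real.log (Real.log 6)) *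
          w₀ ^ (2 - montgomeryCoeff m 1) +
        8 * H * Real.exp (A₁ + A₂ * Real.log (Real.log 6)) * Λ ^ (montgomeryCoeff m 1 - 1) * (Λ * w₀) ^ (-montgomeryCoeff m 1) := by
  have hΛ0 : 0 < Λ := by linarith
  have hw0 : 0 < w₀ := (one_div_pos.2 hΛ0).trans_le hw1
  set β := montgomeryCoeff m 1 with hβ
  have hβ0 : 0 < β := by have := (montgomeryCoeff_one_bounds m).1; rw [hβ]; linarith
  have hβ1 : β < 1 := (abs_lt.1 (abs_montgomeryCoeff_lt_one m 1)).2
  set M₁ := Real.exp (A₁ + A₂ * Real.log (Real.log 6)) with hM₁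
  set L₁ := A₃ + A₄ * Real.log 6 with hL₁
  have hM₁0 : 0 < M₁ := Real.exp_pos _
  set e : ℝ → ℂ := fun v ↦ exp (((Λ * v : ℝ) : ℂ) * I) with he
  set P : ℕ → ℂ := fun i ↦ ∫ v in (-(1 / 2))..(1 / 2),
    gpiece m Λ α t (η ((i : ℤ) - K₀)) ((i : ℤ) - K₀) v * e v with hP
  set d : ℂ := (α : ℂ) + ((1 - t : ℝ) : ℂ) * I with hdd
  set coef : ℂ := η 1 0 * gOne m Λ 0 / d with hcoef
  -- splitting off `i = K₀` (`k = 0`) and `i = K₀ + 1` (`k = 1`)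
  have hmem0 : K₀ ∈ Finset.range (2 * K₀ + 1) := by rw [Finset.mem_range]; omega
  have hmem1 : K₀ + 1 ∈ (Finset.range (2 * K₀ + 1)).erase K₀ := by
    rw [Finset.mem_erase, Finset.mem_range]; omega
  have hrest : ((Finset.range (2 * K₀ + 1)).erase K₀).erase (K₀ + 1) =
      (Finset.range (2 * K₀ + 1)).filter (fun i ↦ i ≠ K₀ ∧ i ≠ K₀ + 1) := by
    ext i
    simp only [Finset.mem_erase, Finset.mem_range, Finset.mem_filter]
    tauto
  have hsum : ∑ i ∈ Finset.range (2 * K₀ + 1), P i =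
      P K₀ + (P (K₀ + 1) + ∑ i ∈ (Finset.range (2 * K₀ + 1)).filter (fun i ↦ i ≠ K₀ ∧ i ≠ K₀ + 1), P i) := by
    rw [← Finset.add_sum_erase _ _ hmem0, ← Finset.add_sum_erase _ _ hmem1, hrest]
  have hk0 : ((K₀ : ℕ) : ℤ) - (K₀ : ℤ) = 0 := by ring
  have hk1 : (((K₀ + 1 : ℕ)) : ℤ) - (K₀ : ℤ) = 1 := by push_cast; ring
  have hP0 : P K₀ = ∫ v in (-(1 / 2))..(1 / 2), gpiece m Λ α t (η 0) 0 v * e v := by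
    simp only [hP, hk0]
  have hP1 : P (K₀ + 1) = ∫ v in (-(1 / 2))..(1 / 2), gpiece m Λ α t (η 1) 1 v * e v := by
    simp only [hP, hk1]
  -- the pieces `k ∉ {0,1}`
  have hErest := sum_norm_gpieces_le m h18 h19 hA₂ hA₃ hA₄ hΛ (α := α) ht4 η η' hH hηd hηc hηb hηb' K₀
  -- the piece `k = 0`
  have hE0 := norm_gpieceZero_le m h18 h19 hA₃ hA₄ hΛ hα htα ha1 ha2 (hηd 0) (hηc 0) (hηb 0) (hηb' 0)
  -- the piece `k = 1`: flanks
  have hEflank := norm_gpiece_sub_window_le m h18 h19 hA₃ hA₄ hΛ (α := α) ht4 (k := 1) one_ne_zero hw1 hw2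
    (hηd 1) (hηc 1) (hηb 1) (hηb' 1)
  rw [show (|((1 : ℤ) : ℝ)| + 5 : ℝ) = 6 by norm_num, show |((1 : ℤ) : ℝ)| = 1 by norm_num, mul_one,
    ← hβ, max_eq_left hβ0.le] at hEflank
  -- the piece `k = 1`: freezing the window
  have hEwin := norm_gwindowOne_sub_main_le m h18 h19 hA₃ hA₄ hΛ (α := α) ht4 hw1 hw2 hLw (hηd 1) (hηb' 1)
  rw [← hβ] at hEwin
  -- the window kernel: Hankel
  set J : ℂ := ∫ y : ℝ in (-(Λ * w₀))..(Λ * w₀), ((1 : ℂ) + y * I) ^ (-(β : ℂ)) * exp ((1 : ℂ) + y * I) with hJ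
  have hwin_eq : ∫ v in (-w₀)..w₀, (((1 / Λ : ℝ) : ℂ) + v * I) ^ (-(β : ℂ)) * e v =
      ((Λ ^ (β - 1) * Real.exp (-1) : ℝ) : ℂ) * J := by
    have h := integral_window_kernel_eq hΛ0 (mul_pos hΛ0 hw0) β
    rw [show Λ * w₀ / Λ = w₀ by field_simp] at h
    exact h
  have hHankel := norm_hankelLineIntegral_sub_le hβ0 hβ1 (mul_pos hΛ0 hw0)
  rw [← hJ] at hHankel
  -- sizes of the frozen coefficient
  have hη10 : ‖η 1 0‖ ≤ H := hηb 1 0 (by constructor <;> norm_num)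
  have hg1 : ‖gOne m Λ 0‖ ≤ M₁ := (norm_gOne_le m h18 hΛ (v := 0) (by norm_num)).1
  have hdge : 1 / 4 ≤ ‖d‖ := by
    have := norm_pieceDen_ge (α := α) (k := 1) (v := 0) one_ne_zero ht4 (by norm_num)
    simpa [hdd] using this
  have hdpos : 0 < ‖d‖ := by linarith
  have hcoef_le : ‖coef‖ ≤ 4 * H * M₁ := by
    rw [hcoef, norm_div, norm_mul, div_le_iff₀ hdpos]
    calc ‖η 1 0‖ * ‖gOne m Λ 0‖ ≤ H * M₁ := mul_le_mul hη10 hg1 (norm_nonneg _) hH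
      _ = 4 * H * M₁ * (1 / 4) := by ring
      _ ≤ 4 * H * M₁ * ‖d‖ := mul_le_mul_of_nonneg_left hdge (by positivity)
  -- assembling the piece `k = 1`
  set W : ℂ := ∫ v in (-w₀)..w₀, gpiece m Λ α t (η 1) 1 v * e v with hW
  set MainJ : ℂ := coef * (((Λ ^ (β - 1) * Real.exp (-1) : ℝ) : ℂ) * J) with hMainJ
  set Main : ℂ := coef * (((Λ ^ (β - 1) * Real.exp (-1) : ℝ) : ℂ) * ((2 * Real.pi / Real.Gamma β : ℝ) : ℂ))
    with hMain
  have hWmain : ‖W - MainJ‖ ≤ (‖η 1 0‖ * (16 * L₁ + 32) + 16 * H) * M₁ * w₀ ^ (2 - β) := by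
    rw [hMainJ, ← hwin_eq]; exact hEwin
  have hWmain' : ‖W - MainJ‖ ≤ (H * (16 * L₁ + 32) + 16 * H) * M₁ * w₀ ^ (2 - β) := by
    refine hWmain.trans ?_
    have hL₁0 : 0 ≤ L₁ := add_nonneg hA₃ (mul_nonneg hA₄ (Real.log_nonneg (by norm_num)))
    have h1 : ‖η 1 0‖ * (16 * L₁ + 32) + 16 * H ≤ H * (16 * L₁ + 32) + 16 * H :=
      add_le_add (mul_le_mul_of_nonneg_right hη10 (by linarith)) le_rfl
    exact mul_le_mul_of_nonneg_right (mul_le_mul_of_nonneg_right h1 hM₁0.le) (Real.rpow_nonneg hw0.le _)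
  have hJmain : ‖MainJ - Main‖ ≤ 8 * H * M₁ * Λ ^ (β - 1) * (Λ * w₀) ^ (-β) := by
    have hfac : MainJ - Main = coef * ((Λ ^ (β - 1) * Real.exp (-1) : ℝ) : ℂ) *
        (J - ((2 * Real.pi / Real.Gamma β : ℝ) : ℂ)) := by
      simp only [hMainJ, hMain]; ring
    rw [hfac, norm_mul, norm_mul, norm_real, Real.norm_eq_abs, abs_of_pos (by positivity)]
    calc ‖coef‖ * (Λ ^ (β - 1) * Real.exp (-1)) * ‖J - ((2 * Real.pi / Real.Gamma β : ℝ) : ℂ)‖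
        ≤ (4 * H * M₁) * (Λ ^ (β - 1) * Real.exp (-1)) * (2 * Real.exp 1 * (Λ * w₀) ^ (-β)) := by
          refine mul_le_mul (mul_le_mul_of_nonneg_right hcoef_le (by positivity)) hHankel (norm_nonneg _)
            (by positivity)
      _ = 8 * H * M₁ * Λ ^ (β - 1) * (Λ * w₀) ^ (-β) * (Real.exp (-1) * Real.exp 1) := by ring
      _ = _ := by rw [← Real.exp_add, neg_add_cancel, Real.exp_zero, mul_one]
  have hP1W : ‖P (K₀ + 1) - W‖ ≤ 16 * M₁ * H / Λ * (2 * w₀ ^ (-β) + 3 * (L₁ + 1) + 14) := by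
    rw [hP1, hW]
    refine hEflank.trans (le_of_eq ?_)
    simp only [hM₁, hL₁]
  -- conclusion
  rw [hsum]
  have hgoal : P K₀ + (P (K₀ + 1) + ∑ i ∈ (Finset.range (2 * K₀ + 1)).filter (fun i ↦ i ≠ K₀ ∧ i ≠ K₀ + 1), P i) -
      Main = (∑ i ∈ (Finset.range (2 * K₀ + 1)).filter (fun i ↦ i ≠ K₀ ∧ i ≠ K₀ + 1), P i) + P K₀ +
        (P (K₀ + 1) - W) + (W - MainJ) + (MainJ - Main) := by ring
  rw [hgoal]
  rw [hP0] at hsum ⊢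
  set Srest := ∑ i ∈ (Finset.range (2 * K₀ + 1)).filter (fun i ↦ i ≠ K₀ ∧ i ≠ K₀ + 1), P i with hSrest
  set P0 := ∫ v in (-(1 / 2))..(1 / 2), gpiece m Λ α t (η 0) 0 v * e v with hP0def
  have hSrest_le : ‖Srest‖ ≤ Real.exp (A₁ + A₂ * Real.log (Real.log ((K₀ : ℝ) + 5))) * H / Λ *
      (40 * Λ ^ (1 / 3 : ℝ) + 48 * (A₃ + A₄ * Real.log ((K₀ : ℝ) + 5) + 1) + 224) * (2 * (1 + Real.log K₀)) :=
    (norm_sum_le _ _).trans hErest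
  calc ‖Srest + P0 + (P (K₀ + 1) - W) + (W - MainJ) + (MainJ - Main)‖
      ≤ ‖Srest‖ + ‖P0‖ + ‖P (K₀ + 1) - W‖ + ‖W - MainJ‖ + ‖MainJ - Main‖ := by
        refine (norm_add_le _ _).trans (add_le_add ?_ le_rfl)
        refine (norm_add_le _ _).trans (add_le_add ?_ le_rfl)
        refine (norm_add_le _ _).trans (add_le_add ?_ le_rfl)
        exact norm_add_le _ _
    _ ≤ _ := add_le_add (add_le_add (add_le_add (add_le_add hSrest_le hE0) hP1W) hWmain') hJmain

end PieceBounds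

/-! ## The kernel integral along `Re(s+w) = 1 + 1/log x` as a sum of pieces -/

/-- **The smoothed-kernel integral split into unit pieces** (the analogue of `perron_integral_eq_sum_pieces`
for a kernel `x^w η̃(u)/w`, `w = α + iu`): with `Λ = log x ≥ 2`, `Re s + α = 1 + 1/Λ`, `α ≠ 0`, `t = Im s`,
`∫_{-(K₀+1/2+t)}^{K₀+1/2-t} f(s+α+iu) x^{α+iu} η̃(u)/(α+iu) du = x^α Σ_{k=-K₀}^{K₀} ∫_{-1/2}^{1/2} h_k η_k e^{iΛv} dv`
with `η_k(v) = x^{i(k−t)} η̃(k+v−t)`. [cite: Montgomery1983, §4 (20)–(21)] -/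
theorem kernel_integral_eq_sum_gpieces {x : ℝ} (hx1 : 1 < x) (hx : 2 ≤ Real.log x) {s : ℂ} {α : ℝ}
    (hσ : s.re + α = 1 + 1 / Real.log x) (hα : α ≠ 0) {ηt : ℝ → ℂ} (hηt : Continuous ηt) (K₀ : ℕ) :
    ∫ u in (-((K₀ : ℝ) + 1 / 2 + s.im))..((K₀ : ℝ) + 1 / 2 - s.im),
        montgomeryF m (s + α + u * I) * (x : ℂ) ^ ((α : ℂ) + u * I) * (ηt u / ((α : ℂ) + u * I)) =
      (x : ℂ) ^ (α : ℂ) * ∑ i ∈ Finset.range (2 * K₀ + 1),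
        ∫ v in (-(1 / 2))..(1 / 2), gpiece m (Real.log x) α s.im
          (fun v ↦ (x : ℂ) ^ (((((i : ℤ) - K₀ : ℤ) : ℝ) - s.im : ℝ) * I) *
            ηt ((((i : ℤ) - K₀ : ℤ) : ℝ) + v - s.im)) ((i : ℤ) - K₀) v *
            exp (((Real.log x * v : ℝ) : ℂ) * I) := by
  set Λ := Real.log x with hΛ
  have hΛ0 : 0 < Λ := by linarith
  have hx0 : 0 < x := by linarith
  have hxc : (x : ℂ) ≠ 0 := ofReal_ne_zero.2 hx0.ne'
  set t := s.im with ht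
  set σ := s.re with hσ'
  set G : ℝ → ℂ := fun u ↦ montgomeryF m (s + α + u * I) * (x : ℂ) ^ ((α : ℂ) + u * I) *
    (ηt u / ((α : ℂ) + u * I)) with hG
  have hre : ∀ u : ℝ, (s + α + u * I).re = 1 + 1 / Λ := fun u ↦ by simp [← hσ', hσ]
  have hden : ∀ u : ℝ, (α : ℂ) + u * I ≠ 0 := fun u h ↦ by
    have := congrArg Complex.re h; simp at this; exact hα this
  have hGc : Continuous G := by
    have h1 : Continuous fun u : ℝ ↦ montgomeryF m (s + α + u * I) := by
      refine continuous_iff_continuousAt.2 fun u ↦ ?_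
      have hd := differentiableAt_montgomeryF m (z := s + α + u * I) (by rw [hre]; linarith [one_div_pos.2 hΛ0])
        (by rw [hre]; have : 1 / Λ ≤ 1 / 2 := one_div_le_one_div_of_le (by norm_num) hx; linarith)
      exact hd.continuousAt.comp (f := fun u : ℝ ↦ s + α + u * I) (by fun_prop)
    have h2 : Continuous fun u : ℝ ↦ (x : ℂ) ^ ((α : ℂ) + u * I) := by
      simp_rw [ofReal_cpow_eq_exp hx0]; fun_prop
    simp only [hG]
    exact (h1.mul h2).mul (hηt.div (by fun_prop) hden)
  -- Step 1: `u = y - t`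
  have h1 : ∫ u in (-((K₀ : ℝ) + 1 / 2 + t))..((K₀ : ℝ) + 1 / 2 - t), G u =
      ∫ y in (-(K₀ : ℝ) - 1 / 2)..((K₀ : ℝ) + 1 / 2), G (y - t) := by
    rw [intervalIntegral.integral_comp_sub_right G t]
    congr 1; ring
  -- Step 2: unit pieces
  set a : ℕ → ℝ := fun i ↦ (-(K₀ : ℝ) - 1 / 2) + i with ha
  have hadj := intervalIntegral.sum_integral_adjacent_intervals (f := fun y ↦ G (y - t)) (a := a) (μ := volume)
    (n := 2 * K₀ + 1) (fun i _ ↦ (hGc.comp (continuous_sub_right t)).intervalIntegrable (a i) (a (i + 1)))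
  have ha0 : a 0 = -(K₀ : ℝ) - 1 / 2 := by simp [ha]
  have han : a (2 * K₀ + 1) = (K₀ : ℝ) + 1 / 2 := by simp only [ha]; push_cast; ring
  rw [ha0, han] at hadj
  -- Step 3: each piece
  have hpiece : ∀ i ∈ Finset.range (2 * K₀ + 1), ∫ y in (a i)..(a (i + 1)), G (y - t) =
      (x : ℂ) ^ (α : ℂ) * ∫ v in (-(1 / 2))..(1 / 2), gpiece m Λ α t
        (fun v ↦ (x : ℂ) ^ (((((i : ℤ) - K₀ : ℤ) : ℝ) - t : ℝ) * I) * ηt ((((i : ℤ) - K₀ : ℤ) : ℝ) + v - t))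
        ((i : ℤ) - K₀) v * exp (((Λ * v : ℝ) : ℂ) * I) := by
    intro i _
    set k : ℤ := (i : ℤ) - K₀ with hk
    have hkR : (k : ℝ) = (i : ℝ) - K₀ := by rw [hk]; push_cast; ring
    have hai : a i = -(1 / 2) + (k : ℝ) := by simp only [ha, hkR]; ring
    have hai1 : a (i + 1) = 1 / 2 + (k : ℝ) := by simp only [ha, hkR]; push_cast; ring
    rw [hai, hai1, ← intervalIntegral.integral_comp_add_right (fun y ↦ G (y - t)) (k : ℝ),
      ← intervalIntegral.integral_const_mul]
    refine intervalIntegral.integral_congr fun v _ ↦ ?_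
    have hz : s + α + (((v + k - t : ℝ)) : ℂ) * I = zline Λ (k + v) := by
      apply Complex.ext
      · simp [zline, ← hσ', hσ]
      · simp [zline, ← ht]; ring
    have hcpow : (x : ℂ) ^ ((α : ℂ) + ((v + k - t : ℝ) : ℂ) * I) =
        (x : ℂ) ^ (α : ℂ) * ((x : ℂ) ^ ((((k : ℝ) - t : ℝ) : ℂ) * I) * exp (((Λ * v : ℝ) : ℂ) * I)) := by
      rw [ofReal_cpow_eq_exp hx0, ofReal_cpow_eq_exp hx0, ofReal_cpow_eq_exp hx0, ← exp_add, ← exp_add]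
      congr 1
      push_cast
      ring
    have harg : v + (k : ℝ) - t = (k : ℝ) + v - t := by ring
    have hd0 := hden ((k : ℝ) + v - t)
    simp only [hG]
    rw [show ((v + (k : ℝ) - t : ℝ) : ℂ) = ((v + k - t : ℝ) : ℂ) by push_cast; ring] at *
    rw [show s + ↑α + ↑(v + ↑k - t) * I = zline Λ (k + v) from hz, hcpow, gpiece, pieceFun, harg]
    field_simp
  calc ∫ u in (-((K₀ : ℝ) + 1 / 2 + t))..((K₀ : ℝ) + 1 / 2 - t), G u
      = ∫ y in (-(K₀ : ℝ) - 1 / 2)..((K₀ : ℝ) + 1 / 2), G (y - t) := h1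
    _ = ∑ i ∈ Finset.range (2 * K₀ + 1), ∫ y in (a i)..(a (i + 1)), G (y - t) := hadj.symm
    _ = _ := by rw [Finset.sum_congr rfl hpiece, ← Finset.mul_sum]

end Line

end Literature.Barriers.RiemannHypothesis

end
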